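import Summits.HodgeConjecture.HodgeConjecture.Theses.TropicalWeilObstruction
import Summits.HodgeConjecture.HodgeConjecture.Theorems.TropicalWeilVanishing.Negative.FalseWithoutIsWeilGeneric
import HarnessLib

/-!
# Crux `TropicalWeilVanishing` (stmt-HodgeConjecture-18478) — KONTSEVICH'S CERTIFICATE PRINCIPLE in the
# tree's vocabulary: a periodic, alternating STOKES PRIMITIVE for the Weil density on `X_Q` forces `W ≡ 0`
# on `X_Q`; and NO translation-invariant Stokes primitive exists (the combinatorial core of the no-go Φ2)

Route `TropicalWeilObstruction` of `HodgeConjecture`; cell `pub-hodge-tropical` (Hodge NEGATION SINK — scoped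
exploration, cap 2 seats, no summit claim), seat tropical-1 gen 16 (`prover-pub-hodge-tropical-1-g16-0`, 2026-08-24).
HONEST FRAMING: bookkeeping about a METHOD. Kontsevich's proposal (Zharkov 2020, pp. 3–4) is to PROVE the crux K1
(`TropicalWeilVanishing`: every effective tropical `4`-cycle on a Weil-generic `X_Q = ℝ⁸/Qℤ⁸` has `W = 0`) by a linear
map `Φ` on affine flags such that "`Φ ∘ α = vol` modulo the Weil directions". In the cell's exact form (HOME
`certificates/signedcycles/PHI-ANSATZ.md` §1, refereed): a STOKES PRIMITIVE on `X_Q` is a map `Φ` from ordered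
`(n−1)`-simplices of `X_Q` (here: `n` points of `ℝ^{2n}`) to ℤ-additive functionals on Plücker vectors
(`((Fin n → Fin 2n) → ℤ) →+ ℂ`) which is (i) PERIODIC under `Q·ℤ^{2n}`, (ii) ALTERNATING in the vertices, and
(iii) satisfies, for every weighted framed lattice `n`-simplex `c` (`TropicalCell`), the STOKES identity
`Σ_i (−1)^i Φ(∂_i c)(p_c) = a_c · η_c²` — the cellwise Weil density of `weilFunctional`. This file proves:

* `weilFunctional_eq_zero_of_stokesPrimitive` — (i)+(ii)+(iii) ⟹ `weilFunctional Z = 0` for EVERY effective tropical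
  `n`-cycle `Z` on `X_Q` (any `n`, any `Q`): summing (iii) over the cells, glued facets are period translates of a
  re-ordered common reference simplex (`facet_eq`), so by (i)+(ii) they carry `± Φ(refFacet)`, and each facet class
  contributes `Φ(refFacet)(Σ ±w_σ p_σ) = Φ(refFacet)(0) = 0` by the balancing certificate (`balanced`). This is the
  "⟸" half of PHI-ANSATZ §1's Claim `K1 ⟺ ∃Φ`, stated for honest (not formal) simplices; the "⟹" half is ℚ-linear
  duality plus the cell's effective-domination theorem (paper) and is not formalised.
* `tropicalWeilVanishing_of_stokesPrimitives` — hence a family of Stokes primitives, one on each Weil-generic `X_Q`,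
  PROVES the crux `TropicalWeilObstruction.TropicalWeilVanishing` (typed against the route declaration).
* `no_translationInvariant_stokesPrimitive` — there is NO Stokes primitive (for `n = 4`) that is invariant under ALL
  translations of `ℝ⁸`: such a `Φ` is `1·ℤ⁸`-periodic, so by the first theorem the Kuhn–Freudenthal subtorus cycle
  `Negative.kuhnCycle` on `ℝ⁸/ℤ⁸` (refuter file, p171405; `W(kuhnCycle) = 1`) would have `W = 0`. This is the
  combinatorial core of the cell's PROPOSITION Φ2 (K1-SCOPE §10 (b), tropical-1 gen 16): a Stokes primitive on any
  `X_Q` that is Haar-INTEGRABLE in position averages over the torus to a translation-invariant one — so Kontsevich's `Φ`,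
  if it exists, is never `∫_τ β` with `β ∈ L¹_loc`, never continuous or bounded in position (the averaging step is
  measure theory on paper; only its target, "no translation-invariant primitive", is kernel-checked here). Together with
  THEOREM F1 (tropical-2 gen 15, kernel `…CMWeights`: no primitive POLYNOMIAL in the archimedean data) it bounds the shape
  of any explicit K1-certificate. It decides nothing about K1 (OPEN — an open problem) and nothing here bears on the Hodge
  conjecture. negation-sink work. No definition, no named fact, no sorry; imports the route file and the Negative file only.

## References

* [Zharkov2020TropicalWeil] I. Zharkov, Tropical abelian varieties, Weil classes and the Hodge conjecture,
  arXiv:2002.02347 (2020), pp. 3–4 (Kontsevich's `Φ`: "the diagram commutes modulo a proper sublattice … then there will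
  be a Hodge class not represented by any algebraic cycle, since all such cycles are killed by `Φ ∘ α`").
* [MikhalkinZharkov2014Eigenwave] G. Mikhalkin, I. Zharkov, Tropical eigenwave and intermediate Jacobians, LN UMI 15
  (2014), Def. 4.2, Prop. 4.3 (balanced framed cycles; the cycle class).
-/

set_option linter.dupNamespace false

namespace Summit.HodgeConjecture.HodgeConjecture.Theorems.TropicalWeilVanishing.StokesPrimitive

open Literature.AlgebraicGeometry.Tropical Matrix
open scoped BigOperators

/-- **A periodic alternating Stokes primitive kills the Weil functional** (the certificate principle behind
Kontsevich's `Φ`, Zharkov 2020 pp. 3–4, in the tree's vocabulary; any `n`, any period matrix `Q`). Let `Φ` send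
each ordered `(n−1)`-simplex `τ` of `ℝ^{2n}` (`n` vertices) to a ℤ-additive functional on Plücker vectors, and assume
(i) `Φ(τ + Q m) = Φ(τ)` for `m ∈ ℤ^{2n}`, (ii) `Φ(τ ∘ ρ) = sign ρ · Φ(τ)` for every re-ordering `ρ`, (iii) for every
weighted framed lattice `n`-simplex `c`: `Σ_i (−1)^i Φ(i-th facet of c)(p_c) = a_c · η_c²` (`p_c` the Plücker vector of
the frame, `a_c` the lattice volume, `η_c` the complex frame determinant). Then every effective tropical `n`-cycle `Z` on
`ℝ^{2n}/Qℤ^{2n}` has `weilFunctional Z = 0`: by (iii) `W(Z) = Σ_σ w_σ Σ_i (−1)^i Φ(∂_iσ)(p_σ)`; by `facet_eq` the `i`-th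
facet of `σ` is the `Q·facetShift`-translate of the reference simplex of its class re-ordered by `facetPerm`, so by
(i)+(ii) its `Φ` is `sign(facetPerm)·Φ(refFacet)`; regrouping by facet class, each class contributes
`Φ(refFacet f)(Σ_{(σ,i) ∈ f} (−1)^i sign π_{σ,i} w_σ p_σ) = Φ(refFacet f)(0) = 0` by `balanced`.
[cite: Zharkov2020TropicalWeil, pp. 3–4] -/
theorem weilFunctional_eq_zero_of_stokesPrimitive {n : ℕ} {Q : Matrix (Fin (2 * n)) (Fin (2 * n)) ℝ}
    (Φ : (Fin n → Fin (2 * n) → ℝ) → (((Fin n → Fin (2 * n)) → ℤ) →+ ℂ))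
    (hper : ∀ (τ : Fin n → Fin (2 * n) → ℝ) (m : Fin (2 * n) → ℤ),
        Φ (fun j a => τ j a + ∑ b, Q a b * (m b : ℝ)) = Φ τ)
    (halt : ∀ (τ : Fin n → Fin (2 * n) → ℝ) (ρ : Equiv.Perm (Fin n)) (v : (Fin n → Fin (2 * n)) → ℤ),
        Φ (fun j => τ (ρ j)) v = (((Equiv.Perm.sign ρ : ℤˣ) : ℤ) : ℂ) * Φ τ v)
    (hstokes : ∀ c : TropicalCell (2 * n) n,
        ∑ i : Fin (n + 1), (-1 : ℂ) ^ (i : ℕ) * Φ (fun j => c.vertex (i.succAbove j)) (pluckerCoord c.frame)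
          = (c.latticeVolume : ℂ) * frameComplexDet n c.frame ^ 2)
    (Z : TropicalTorusCycle (2 * n) n Q) : weilFunctional Z = 0 := by
  classical
  -- the facet `(σ, i)` of the cycle carries `sign(facetPerm σ i) · Φ(refFacet (facetClass σ i))`
  have hfacet : ∀ (σ : Fin Z.numCells) (i : Fin (n + 1)) (v : (Fin n → Fin (2 * n)) → ℤ),
      Φ (fun j => (Z.cell σ).vertex (i.succAbove j)) v
        = (((Equiv.Perm.sign (Z.facetPerm σ i) : ℤˣ) : ℤ) : ℂ) * Φ (Z.refFacet (Z.facetClass σ i)) v := by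
    intro σ i v
    set π := Z.facetPerm σ i with hπ
    set τ' : Fin n → Fin (2 * n) → ℝ :=
      fun j a => Z.refFacet (Z.facetClass σ i) j a + ∑ b, Q a b * (Z.facetShift σ i b : ℝ) with hτ'
    have hfun : (fun j => (Z.cell σ).vertex (i.succAbove j)) = fun j => τ' (π⁻¹ j) := by
      funext j a
      have h := Z.facet_eq σ i (π⁻¹ j) a
      have hj : π (π⁻¹ j) = j := π.apply_symm_apply j
      rw [← hπ, hj] at h
      simpa [hτ'] using h
    rw [hfun, halt τ' π⁻¹ v, Equiv.Perm.sign_inv, hτ', hper]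
  -- the Weil functional, cell by cell, through Stokes and `hfacet`
  have hW : weilFunctional Z = ∑ σ, ∑ i : Fin (n + 1),
      ((((Z.cell σ).weight : ℤ) * (-1) ^ (i : ℕ) *
          ((Equiv.Perm.sign (Z.facetPerm σ i) : ℤˣ) : ℤ) : ℤ) : ℂ) *
        Φ (Z.refFacet (Z.facetClass σ i)) (pluckerCoord (Z.cell σ).frame) := by
    unfold weilFunctional
    refine Finset.sum_congr rfl fun σ _ => ?_
    rw [mul_assoc, ← hstokes (Z.cell σ), Finset.mul_sum]
    refine Finset.sum_congr rfl fun i _ => ?_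
    rw [hfacet]
    push_cast
    ring
  -- regroup by facet class: each class pairs `Φ(refFacet f)` with the balanced (hence zero) signed frame sum
  have hv : ∀ f : Fin Z.numFacetClasses,
      (∑ σ, ∑ i : Fin (n + 1),
        (if Z.facetClass σ i = f then
          (((Z.cell σ).weight : ℤ) * (-1) ^ (i : ℕ) * ((Equiv.Perm.sign (Z.facetPerm σ i) : ℤˣ) : ℤ)) •
            pluckerCoord (Z.cell σ).frame
        else 0 : (Fin n → Fin (2 * n)) → ℤ)) = 0 := by
    intro f
    funext S
    simp only [Finset.sum_apply, Pi.zero_apply]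
    have hb := Z.balanced f S
    refine Eq.trans (Finset.sum_congr rfl fun σ _ => Finset.sum_congr rfl fun i _ => ?_) hb
    split_ifs <;> simp [Pi.smul_apply]
  have hregroup : weilFunctional Z = ∑ f : Fin Z.numFacetClasses, Φ (Z.refFacet f)
      (∑ σ, ∑ i : Fin (n + 1),
        (if Z.facetClass σ i = f then
          (((Z.cell σ).weight : ℤ) * (-1) ^ (i : ℕ) * ((Equiv.Perm.sign (Z.facetPerm σ i) : ℤˣ) : ℤ)) •
            pluckerCoord (Z.cell σ).frame
        else 0 : (Fin n → Fin (2 * n)) → ℤ)) := by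
    rw [hW]
    symm
    simp only [map_sum]
    rw [Finset.sum_comm]
    refine Finset.sum_congr rfl fun σ _ => ?_
    rw [Finset.sum_comm]
    refine Finset.sum_congr rfl fun i _ => ?_
    rw [Finset.sum_eq_single (Z.facetClass σ i)]
    · rw [if_pos rfl, map_zsmul, zsmul_eq_mul]
    · intro f _ hf
      rw [if_neg (Ne.symm hf), map_zero]
    · intro h
      exact absurd (Finset.mem_univ _) h
  rw [hregroup]
  refine Finset.sum_eq_zero fun f _ => ?_
  rw [hv f, map_zero]

/-- **Kontsevich's certificate principle ⟹ the crux.** If on every Weil-generic tropical Weil eightfold `X_Q`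
(`Q ≻ 0`, `QJ = JQ`, `IsWeilGeneric 4 Q`) there is a periodic, alternating Stokes primitive for the Weil density,
then K1 (`TropicalWeilObstruction.TropicalWeilVanishing`) holds. (The converse, `K1 ⟹ ∃Φ`, is ℚ-linear duality
plus effective domination and is a paper statement of the cell; PHI-ANSATZ §1.) This is the exact sense in which a
"linear certificate" would PROVE the crux; THEOREM F1 and Proposition Φ2 of the cell say such a `Φ` is neither
polynomial in the archimedean data nor integrable in position. [cite: Zharkov2020TropicalWeil, pp. 3–4] -/
theorem tropicalWeilVanishing_of_stokesPrimitives
    (h : ∀ Q : Matrix (Fin (2 * 4)) (Fin (2 * 4)) ℝ, Q.PosDef → Q * weilJ 4 = weilJ 4 * Q →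
      IsWeilGeneric 4 Q →
      ∃ Φ : (Fin 4 → Fin (2 * 4) → ℝ) → (((Fin 4 → Fin (2 * 4)) → ℤ) →+ ℂ),
        (∀ (τ : Fin 4 → Fin (2 * 4) → ℝ) (m : Fin (2 * 4) → ℤ),
            Φ (fun j a => τ j a + ∑ b, Q a b * (m b : ℝ)) = Φ τ) ∧
        (∀ (τ : Fin 4 → Fin (2 * 4) → ℝ) (ρ : Equiv.Perm (Fin 4)) (v : (Fin 4 → Fin (2 * 4)) → ℤ),
            Φ (fun j => τ (ρ j)) v = (((Equiv.Perm.sign ρ : ℤˣ) : ℤ) : ℂ) * Φ τ v) ∧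
        (∀ c : TropicalCell (2 * 4) 4,
            ∑ i : Fin (4 + 1), (-1 : ℂ) ^ (i : ℕ) * Φ (fun j => c.vertex (i.succAbove j)) (pluckerCoord c.frame)
              = (c.latticeVolume : ℂ) * frameComplexDet 4 c.frame ^ 2)) :
    Summit.HodgeConjecture.HodgeConjecture.Theses.TropicalWeilObstruction.TropicalWeilVanishing := by
  intro Q hQ hJ hgen Z
  obtain ⟨Φ, hper, halt, hstokes⟩ := h Q hQ hJ hgen
  exact weilFunctional_eq_zero_of_stokesPrimitive Φ hper halt hstokes Z

/-- **No translation-invariant Stokes primitive** (combinatorial core of the cell's Proposition Φ2, K1-SCOPE §10 (b)).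
There is no alternating Stokes primitive for the Weil density (`n = 4`) that is invariant under ALL translations of
`ℝ⁸` — equivalently, none that depends on a facet only through its SHAPE (edge vectors): such a `Φ` is in particular
`ℤ⁸`-periodic on the standard torus `ℝ⁸/ℤ⁸` (`Q = 1`), where the refuter's Kuhn–Freudenthal subtorus cycle
`Negative.kuhnCycle` (the coordinate `4`-torus `ℝ⁴/ℤ⁴ × 0`, 24 cells, `W = 1`) contradicts
`weilFunctional_eq_zero_of_stokesPrimitive`. Consequence on paper (Φ2): a Stokes primitive on any `X_Q` that is
Haar-integrable in position would average to a translation-invariant one; so Kontsevich's `Φ` is unbounded / non-`L¹`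
in position for facets inside every totally real rational `4`-plane. [cite: Zharkov2020TropicalWeil, pp. 3–4] -/
theorem no_translationInvariant_stokesPrimitive
    (Φ : (Fin 4 → Fin (2 * 4) → ℝ) → (((Fin 4 → Fin (2 * 4)) → ℤ) →+ ℂ))
    (hinv : ∀ (τ : Fin 4 → Fin (2 * 4) → ℝ) (v : Fin (2 * 4) → ℝ), Φ (fun j a => τ j a + v a) = Φ τ)
    (halt : ∀ (τ : Fin 4 → Fin (2 * 4) → ℝ) (ρ : Equiv.Perm (Fin 4)) (v : (Fin 4 → Fin (2 * 4)) → ℤ),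
        Φ (fun j => τ (ρ j)) v = (((Equiv.Perm.sign ρ : ℤˣ) : ℤ) : ℂ) * Φ τ v)
    (hstokes : ∀ c : TropicalCell (2 * 4) 4,
        ∑ i : Fin (4 + 1), (-1 : ℂ) ^ (i : ℕ) * Φ (fun j => c.vertex (i.succAbove j)) (pluckerCoord c.frame)
          = (c.latticeVolume : ℂ) * frameComplexDet 4 c.frame ^ 2) : False := by
  have hper : ∀ (τ : Fin 4 → Fin (2 * 4) → ℝ) (m : Fin (2 * 4) → ℤ),
      Φ (fun j a => τ j a + ∑ b, (1 : Matrix (Fin (2 * 4)) (Fin (2 * 4)) ℝ) a b * (m b : ℝ)) = Φ τ :=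
    fun τ m => hinv τ _
  have h := weilFunctional_eq_zero_of_stokesPrimitive Φ hper halt hstokes Negative.kuhnCycle
  rw [Negative.weilFunctional_kuhnCycle] at h
  exact one_ne_zero h

/-- The same, read as a property every Stokes primitive must have: if `Φ` is an alternating Stokes primitive for the
Weil density (`n = 4`), then it is NOT translation-invariant — some facet `τ` and some translation vector `v` have
`Φ(τ + v) ≠ Φ(τ)`. (Position-dependence is forced; by Φ2's averaging argument it is moreover non-integrable.)
[cite: Zharkov2020TropicalWeil, pp. 3–4] -/
theorem stokesPrimitive_not_translationInvariant
    (Φ : (Fin 4 → Fin (2 * 4) → ℝ) → (((Fin 4 → Fin (2 * 4)) → ℤ) →+ ℂ))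
    (halt : ∀ (τ : Fin 4 → Fin (2 * 4) → ℝ) (ρ : Equiv.Perm (Fin 4)) (v : (Fin 4 → Fin (2 * 4)) → ℤ),
        Φ (fun j => τ (ρ j)) v = (((Equiv.Perm.sign ρ : ℤˣ) : ℤ) : ℂ) * Φ τ v)
    (hstokes : ∀ c : TropicalCell (2 * 4) 4,
        ∑ i : Fin (4 + 1), (-1 : ℂ) ^ (i : ℕ) * Φ (fun j => c.vertex (i.succAbove j)) (pluckerCoord c.frame)
          = (c.latticeVolume : ℂ) * frameComplexDet 4 c.frame ^ 2) :
    ∃ (τ : Fin 4 → Fin (2 * 4) → ℝ) (v : Fin (2 * 4) → ℝ), Φ (fun j a => τ j a + v a) ≠ Φ τ := by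
  by_contra h
  push Not at h
  exact no_translationInvariant_stokesPrimitive Φ h halt hstokes

end Summit.HodgeConjecture.HodgeConjecture.Theorems.TropicalWeilVanishing.StokesPrimitive
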